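import Mathlib
import HarnessLib

/-!
# A `p′`-image inside `GL₂(𝔽_p)` with one stable line has a second one — Maschke for the Borel
# subgroup of `GL₂(𝔽_p)`, ANY prime `p` (the finite-group core of LAW L-irr-p)

Cell `pub/bsd-wall` (D-0145 line `route-BirchSwinnertonDyer-CyclotomicUntwist`), seat `bsd-line-cycu-p4`
(width seat 4, gen 6). THEOREMS ONLY (no definition, no named fact, no `sorry`); pure finite group
theory; BSD is not proved by this file and no crux is. Helper `--supports` K1 (stmt-BirchSwinnertonDyer-21580):
the `p = 3` instance (`…GLTwoFThreeSecondEigenline.exists_second_common_eigenvector`, by `decide`) is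
the core of LAW L-irr3 (`Surj W 3 ↔ Irr W 3` on the cyclic wild cell); this file proves the same
statement for EVERY prime `p` by hand, so that the law «a unique stable line of `E[p]` at `p` and
`E[p]` irreducible force `ρ̄_{E,p}` onto» is available at every `p` (file
`…ModPNonsplitLineImage`), e.g. for the W-ALL rows X9 / X10b (good ordinary `p`, irreducible, not
onto).

**`exists_second_common_eigenvector_of_prime`**: let `f : Γ → GL₂(𝔽_p)` be a homomorphism whose
image stabilises the line of `v ≠ 0` and contains NO element of order divisible by `p`. Then some
`w ≠ 0` off the line of `v` is a common eigenvector too. Proof (§2 in the frame `v = e₀`, §3 by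
conjugation in general): every `f γ` is upper triangular `(a b; 0 d)`; if `a = d` then `b = 0`
(`(a b; 0 a)` with `b ≠ 0` has order divisible by `p`: `((a b; 0 a))ⁿ = (aⁿ, n aⁿ⁻¹ b; 0, aⁿ)`,
§1); so every commutator of the image, being unitriangular, is trivial — the image is ABELIAN; if it
is scalar every line is stable; otherwise pick `f γ₀ = (a b; 0 d)` with `a ≠ d`: its `d`-eigenline
`⟨(b, d − a)⟩` is the full `d`-eigenspace, hence stable under the (commuting) image.

References: J.-P. Serre, Invent. Math. 15 (1972) §2.4 (Borel subgroups) [Serre1972]; H. Maschke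
(complete reducibility in coprime characteristic) — here for the Borel of `GL₂(𝔽_p)` only.
-/

-- single-conjunct summit: `Summit.BirchSwinnertonDyer.BirchSwinnertonDyer.…` repeats the name by design
set_option linter.dupNamespace false
set_option autoImplicit false

namespace Summit.BirchSwinnertonDyer.BirchSwinnertonDyer.Theorems.PSIrrSurjThree

open Matrix

section Prime

variable {p : ℕ} [Fact p.Prime]

/-! ### §1 Upper triangular `2 × 2` matrices over `𝔽_p`: products, inverses, powers -/

/-- Entries of a product of two upper triangular `2 × 2` matrices. [folklore] -/
theorem upper_mul_apply {g h : Matrix (Fin 2) (Fin 2) (ZMod p)} (hg : g 1 0 = 0) (hh : h 1 0 = 0) :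
    (g * h) 1 0 = 0 ∧ (g * h) 0 0 = g 0 0 * h 0 0 ∧ (g * h) 1 1 = g 1 1 * h 1 1 ∧
      (g * h) 0 1 = g 0 0 * h 0 1 + g 0 1 * h 1 1 := by
  simp [Matrix.mul_apply, Fin.sum_univ_two, hg, hh]

/-- The diagonal entries of an invertible upper triangular `2 × 2` matrix are non-zero. [folklore] -/
theorem diag_ne_zero_of_upper (g : GL (Fin 2) (ZMod p))
    (hg : (g : Matrix (Fin 2) (Fin 2) (ZMod p)) 1 0 = 0) :
    (g : Matrix (Fin 2) (Fin 2) (ZMod p)) 0 0 ≠ 0 ∧ (g : Matrix (Fin 2) (Fin 2) (ZMod p)) 1 1 ≠ 0 := by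
  have hdet : (g : Matrix (Fin 2) (Fin 2) (ZMod p)).det ≠ 0 := by
    rw [← Matrix.GeneralLinearGroup.val_det_apply]
    exact (Matrix.GeneralLinearGroup.det g).ne_zero
  rw [Matrix.det_fin_two, hg, mul_zero, sub_zero] at hdet
  exact ⟨left_ne_zero_of_mul hdet, right_ne_zero_of_mul hdet⟩

/-- The inverse of an invertible upper triangular `2 × 2` matrix is upper triangular with inverse
diagonal. [folklore] -/
theorem upper_inv_apply (g : GL (Fin 2) (ZMod p)) (hg : (g : Matrix (Fin 2) (Fin 2) (ZMod p)) 1 0 = 0) :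
    ((g⁻¹ : GL (Fin 2) (ZMod p)) : Matrix (Fin 2) (Fin 2) (ZMod p)) 1 0 = 0 ∧
      ((g⁻¹ : GL (Fin 2) (ZMod p)) : Matrix (Fin 2) (Fin 2) (ZMod p)) 0 0 *
          (g : Matrix (Fin 2) (Fin 2) (ZMod p)) 0 0 = 1 ∧
      ((g⁻¹ : GL (Fin 2) (ZMod p)) : Matrix (Fin 2) (Fin 2) (ZMod p)) 1 1 *
          (g : Matrix (Fin 2) (Fin 2) (ZMod p)) 1 1 = 1 := by
  obtain ⟨h00, h11⟩ := diag_ne_zero_of_upper g hg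
  set gi : Matrix (Fin 2) (Fin 2) (ZMod p) := ((g⁻¹ : GL (Fin 2) (ZMod p)) : Matrix (Fin 2) (Fin 2) (ZMod p))
    with hgi
  have hmul : gi * (g : Matrix (Fin 2) (Fin 2) (ZMod p)) = 1 := by
    rw [hgi, ← Units.val_mul, inv_mul_cancel, Units.val_one]
  have e10 : gi 1 0 * (g : Matrix (Fin 2) (Fin 2) (ZMod p)) 0 0 +
      gi 1 1 * (g : Matrix (Fin 2) (Fin 2) (ZMod p)) 1 0 = 0 := by
    have := congrFun (congrFun hmul 1) 0
    simpa [Matrix.mul_apply, Fin.sum_univ_two] using this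
  have e00 : gi 0 0 * (g : Matrix (Fin 2) (Fin 2) (ZMod p)) 0 0 +
      gi 0 1 * (g : Matrix (Fin 2) (Fin 2) (ZMod p)) 1 0 = 1 := by
    have := congrFun (congrFun hmul 0) 0
    simpa [Matrix.mul_apply, Fin.sum_univ_two] using this
  have e11 : gi 1 0 * (g : Matrix (Fin 2) (Fin 2) (ZMod p)) 0 1 +
      gi 1 1 * (g : Matrix (Fin 2) (Fin 2) (ZMod p)) 1 1 = 1 := by
    have := congrFun (congrFun hmul 1) 1
    simpa [Matrix.mul_apply, Fin.sum_univ_two] using this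
  rw [hg, mul_zero, add_zero] at e10 e00
  have hgi10 : gi 1 0 = 0 := (mul_eq_zero.mp e10).resolve_right h00
  rw [hgi10, zero_mul, zero_add] at e11
  exact ⟨hgi10, e00, e11⟩

/-- Powers of an upper triangular matrix with EQUAL diagonal `(a b; 0 a)`: the diagonal of `Mⁿ` is
`aⁿ`, the lower-left entry is `0`, and `a · (Mⁿ)₀₁ = n · aⁿ · b`. [folklore] -/
theorem upper_pow_apply_of_diag_eq (M : Matrix (Fin 2) (Fin 2) (ZMod p)) (h10 : M 1 0 = 0)
    (hdiag : M 1 1 = M 0 0) (n : ℕ) :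
    (M ^ n) 1 0 = 0 ∧ (M ^ n) 0 0 = M 0 0 ^ n ∧ (M ^ n) 1 1 = M 0 0 ^ n ∧
      M 0 0 * (M ^ n) 0 1 = n * M 0 0 ^ n * M 0 1 := by
  induction n with
  | zero => simp
  | succ n ih =>
    obtain ⟨i10, i00, i11, i01⟩ := ih
    obtain ⟨j10, j00, j11, j01⟩ := upper_mul_apply (g := M ^ n) (h := M) i10 h10
    rw [pow_succ]
    refine ⟨j10, by rw [j00, i00, pow_succ], by rw [j11, i11, hdiag, pow_succ], ?_⟩
    have key : M 0 0 * ((M ^ n) 0 1 * M 1 1) = (n * M 0 0 ^ n * M 0 1) * M 0 0 := by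
      rw [← mul_assoc, i01, hdiag]
    rw [j01, mul_add, key, i00]
    push_cast
    ring

/-- **An invertible upper triangular matrix over `𝔽_p` with equal diagonal entries and order prime to
`p` is scalar** (`b = 0`): otherwise `(a b; 0 a)^m = 1` at `m = ord` forces `m aᵐ b = 0`, `p ∣ m`.
[cite: Serre1972, §2.4] -/
theorem upper_offdiag_eq_zero_of_diag_eq (g : GL (Fin 2) (ZMod p))
    (h10 : (g : Matrix (Fin 2) (Fin 2) (ZMod p)) 1 0 = 0)
    (hdiag : (g : Matrix (Fin 2) (Fin 2) (ZMod p)) 1 1 = (g : Matrix (Fin 2) (Fin 2) (ZMod p)) 0 0)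
    (hp : ¬ p ∣ orderOf g) : (g : Matrix (Fin 2) (Fin 2) (ZMod p)) 0 1 = 0 := by
  by_contra hb
  set M : Matrix (Fin 2) (Fin 2) (ZMod p) := (g : Matrix (Fin 2) (Fin 2) (ZMod p)) with hM
  have ha : M 0 0 ≠ 0 := (diag_ne_zero_of_upper g h10).1
  set m := orderOf g with hm
  have hpow : M ^ m = 1 := by
    rw [hM, ← Units.val_pow_eq_pow_val, pow_orderOf_eq_one, Units.val_one]
  have h := (upper_pow_apply_of_diag_eq M h10 hdiag m).2.2.2
  rw [hpow, Matrix.one_apply_ne (by decide : (0 : Fin 2) ≠ 1), mul_zero] at h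
  have hm0 : (m : ZMod p) = 0 := by
    rcases mul_eq_zero.mp h.symm with h1 | h1
    · rcases mul_eq_zero.mp h1 with h2 | h2
      · exact h2
      · exact absurd h2 (pow_ne_zero _ ha)
    · exact absurd h1 hb
  exact hp ((ZMod.natCast_eq_zero_iff m p).mp hm0)

/-! ### §2 The frame `v = e₀`: an upper triangular `p′`-image is abelian and has a second eigenline -/

/-- `(M *ᵥ e₀) i = M i 0` for `e₀ = Pi.single 0 1`. [folklore] -/
theorem mulVec_single_zero_apply (M : Matrix (Fin 2) (Fin 2) (ZMod p)) (i : Fin 2) :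
    (M *ᵥ Pi.single 0 1) i = M i 0 := by
  fin_cases i <;> simp [Matrix.mulVec, dotProduct, Pi.single_apply]

/-- **Upper triangular `p′`-images commute.** If every `f γ` is upper triangular and has order prime
to `p`, then `f γ * f δ = f δ * f γ`: the commutator is unitriangular of order prime to `p`, hence
trivial (`upper_offdiag_eq_zero_of_diag_eq`). [cite: Serre1972, §2.4] -/
theorem upper_image_comm {Γ : Type*} [Group Γ] (f : Γ →* GL (Fin 2) (ZMod p))
    (hp : ∀ γ : Γ, ¬ p ∣ orderOf (f γ)) (hf : ∀ γ : Γ, (f γ : Matrix (Fin 2) (Fin 2) (ZMod p)) 1 0 = 0)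
    (γ δ : Γ) : f γ * f δ = f δ * f γ := by
  -- the commutator `k = f γ f δ (f γ)⁻¹ (f δ)⁻¹ = f ⁅γ, δ⁆`
  have hk : f γ * f δ * (f γ)⁻¹ * (f δ)⁻¹ = f (γ * δ * γ⁻¹ * δ⁻¹) := by simp [map_mul, map_inv]
  set a := f γ with ha
  set b := f δ with hb
  obtain ⟨ai10, ai00, ai11⟩ := upper_inv_apply a (hf γ)
  obtain ⟨bi10, bi00, bi11⟩ := upper_inv_apply b (hf δ)
  obtain ⟨ab10, ab00, ab11, -⟩ := upper_mul_apply (g := (a : Matrix (Fin 2) (Fin 2) (ZMod p)))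
    (h := (b : Matrix (Fin 2) (Fin 2) (ZMod p))) (hf γ) (hf δ)
  obtain ⟨aba10, aba00, aba11, -⟩ := upper_mul_apply
    (g := ((a * b : GL (Fin 2) (ZMod p)) : Matrix (Fin 2) (Fin 2) (ZMod p)))
    (h := ((a⁻¹ : GL (Fin 2) (ZMod p)) : Matrix (Fin 2) (Fin 2) (ZMod p))) (by rw [Units.val_mul]; exact ab10) ai10
  obtain ⟨k10, k00, k11, -⟩ := upper_mul_apply
    (g := ((a * b * a⁻¹ : GL (Fin 2) (ZMod p)) : Matrix (Fin 2) (Fin 2) (ZMod p)))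
    (h := ((b⁻¹ : GL (Fin 2) (ZMod p)) : Matrix (Fin 2) (Fin 2) (ZMod p))) (by rw [Units.val_mul]; exact aba10) bi10
  rw [Units.val_mul, aba00, Units.val_mul, ab00] at k00
  rw [Units.val_mul, aba11, Units.val_mul, ab11] at k11
  -- `k` is unitriangular
  simp only [Units.val_mul] at k10
  have hk00 : ((a * b * a⁻¹ * b⁻¹ : GL (Fin 2) (ZMod p)) : Matrix (Fin 2) (Fin 2) (ZMod p)) 0 0 = 1 := by
    simp only [Units.val_mul]
    rw [k00]
    linear_combination ((b : Matrix (Fin 2) (Fin 2) (ZMod p)) 0 0 *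
      ((b⁻¹ : GL (Fin 2) (ZMod p)) : Matrix (Fin 2) (Fin 2) (ZMod p)) 0 0) * ai00 + bi00
  have hk11 : ((a * b * a⁻¹ * b⁻¹ : GL (Fin 2) (ZMod p)) : Matrix (Fin 2) (Fin 2) (ZMod p)) 1 1 = 1 := by
    simp only [Units.val_mul]
    rw [k11]
    linear_combination ((b : Matrix (Fin 2) (Fin 2) (ZMod p)) 1 1 *
      ((b⁻¹ : GL (Fin 2) (ZMod p)) : Matrix (Fin 2) (Fin 2) (ZMod p)) 1 1) * ai11 + bi11
  have hk10 : ((a * b * a⁻¹ * b⁻¹ : GL (Fin 2) (ZMod p)) : Matrix (Fin 2) (Fin 2) (ZMod p)) 1 0 = 0 := by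
    simp only [Units.val_mul]
    exact k10
  -- hence trivial
  have hk01 : ((a * b * a⁻¹ * b⁻¹ : GL (Fin 2) (ZMod p)) : Matrix (Fin 2) (Fin 2) (ZMod p)) 0 1 = 0 := by
    refine upper_offdiag_eq_zero_of_diag_eq _ hk10 (by rw [hk00, hk11]) ?_
    rw [ha, hb, hk]
    exact hp _
  have hk1 : a * b * a⁻¹ * b⁻¹ = 1 := by
    apply Matrix.GeneralLinearGroup.ext
    intro i j
    fin_cases i <;> fin_cases j
    · simpa using hk00
    · simpa using hk01
    · simpa using hk10
    · simpa using hk11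
  rw [← commutatorElement_def, commutatorElement_eq_one_iff_mul_comm] at hk1
  exact hk1

/-- **Second eigenline in the frame `v = e₀`.** If every `f γ` is upper triangular (`e₀` is a common
eigenvector) and has order prime to `p`, there is a common eigenvector `w` with `w 1 ≠ 0` (off the line of
`e₀`): either every `f γ` is scalar and `w = e₁` works, or some `f γ₀ = (a b; 0 d)` has `a ≠ d` and
`w = (b, d − a)` is an eigenvector of every `f δ` with eigenvalue `(f δ)₁₁`, by commutativity
(`upper_image_comm`). [cite: Serre1972, §2.4] -/
theorem exists_second_common_eigenvector_single_of_prime {Γ : Type*} [Group Γ]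
    (f : Γ →* GL (Fin 2) (ZMod p)) (hp : ∀ γ : Γ, ¬ p ∣ orderOf (f γ))
    (hf : ∀ γ : Γ, (f γ : Matrix (Fin 2) (Fin 2) (ZMod p)) 1 0 = 0) :
    ∃ w : Fin 2 → ZMod p, w 1 ≠ 0 ∧
      ∀ γ : Γ, ∃ c : ZMod p, (f γ : Matrix (Fin 2) (Fin 2) (ZMod p)) *ᵥ w = c • w := by
  by_cases hscal : ∀ γ : Γ,
      (f γ : Matrix (Fin 2) (Fin 2) (ZMod p)) 1 1 = (f γ : Matrix (Fin 2) (Fin 2) (ZMod p)) 0 0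
  · -- every `f γ` is scalar: `e₁` is an eigenvector
    refine ⟨Pi.single 1 1, by simp, fun γ ↦ ⟨(f γ : Matrix (Fin 2) (Fin 2) (ZMod p)) 1 1, ?_⟩⟩
    have h01 := upper_offdiag_eq_zero_of_diag_eq (f γ) (hf γ) (hscal γ) (hp γ)
    ext i
    fin_cases i <;> simp [Matrix.mulVec, dotProduct, Pi.single_apply, h01]
  · push Not at hscal
    obtain ⟨γ₀, hγ₀⟩ := hscal
    refine ⟨![(f γ₀ : Matrix (Fin 2) (Fin 2) (ZMod p)) 0 1,
        (f γ₀ : Matrix (Fin 2) (Fin 2) (ZMod p)) 1 1 - (f γ₀ : Matrix (Fin 2) (Fin 2) (ZMod p)) 0 0],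
      by simpa using sub_ne_zero.mpr hγ₀, fun δ ↦ ⟨(f δ : Matrix (Fin 2) (Fin 2) (ZMod p)) 1 1, ?_⟩⟩
    -- commutativity gives `a h₀₁ + b h₁₁ = h₀₀ b + h₀₁ d`
    have hcomm := upper_image_comm f hp hf γ₀ δ
    have h01 := congrArg (fun g : GL (Fin 2) (ZMod p) ↦ (g : Matrix (Fin 2) (Fin 2) (ZMod p)) 0 1) hcomm
    simp only [Units.val_mul] at h01
    rw [(upper_mul_apply (hf γ₀) (hf δ)).2.2.2, (upper_mul_apply (hf δ) (hf γ₀)).2.2.2] at h01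
    have hδ := hf δ
    ext i
    fin_cases i
    · simp only [Matrix.mulVec, dotProduct, Fin.sum_univ_two, Fin.zero_eta, Fin.isValue, Matrix.cons_val_zero,
        Matrix.cons_val_one, Pi.smul_apply, smul_eq_mul]
      linear_combination (-1 : ZMod p) * h01
    · simp only [Matrix.mulVec, dotProduct, Fin.sum_univ_two, Fin.mk_one, Fin.isValue, Matrix.cons_val_zero,
        Matrix.cons_val_one, Pi.smul_apply, smul_eq_mul, hδ, zero_mul, zero_add]

/-! ### §3 Any stable line: conjugate to the frame `v = e₀` -/

/-- **The core of LAW L-irr-p, any prime `p`.** Let `f : Γ → GL₂(𝔽_p)` be a homomorphism such that NO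
`f γ` has order divisible by `p`, and let `v ≠ 0` be a common eigenvector of the image. Then there is a
second common eigenvector `w ≠ 0` off the line of `v` (conjugate `v` to `e₀` and use
`exists_second_common_eigenvector_single_of_prime`). Contrapositive: a plane representation over `𝔽_p`
with EXACTLY one stable line has an element of order divisible by `p` in its image.
[cite: Serre1972, §2.4 Prop. 15] -/
theorem exists_second_common_eigenvector_of_prime {Γ : Type*} [Group Γ] (f : Γ →* GL (Fin 2) (ZMod p))
    (hp : ∀ γ : Γ, ¬ p ∣ orderOf (f γ)) {v : Fin 2 → ZMod p} (hv : v ≠ 0)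
    (hfv : ∀ γ : Γ, ∃ c : ZMod p, (f γ : Matrix (Fin 2) (Fin 2) (ZMod p)) *ᵥ v = c • v) :
    ∃ w : Fin 2 → ZMod p, w ≠ 0 ∧ (∀ k : ZMod p, w ≠ k • v) ∧
      ∀ γ : Γ, ∃ c : ZMod p, (f γ : Matrix (Fin 2) (Fin 2) (ZMod p)) *ᵥ w = c • w := by
  -- a matrix `P` with first column `v`
  obtain ⟨u₀, u₁, hdet⟩ : ∃ u₀ u₁ : ZMod p, (!![v 0, u₀; v 1, u₁] : Matrix (Fin 2) (Fin 2) (ZMod p)).det ≠ 0 := by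
    by_cases h0 : v 0 = 0
    · have h1 : v 1 ≠ 0 := by
        intro h1; apply hv; ext i; fin_cases i <;> simp [h0, h1]
      exact ⟨1, 0, by rw [Matrix.det_fin_two_of]; simpa [h0] using h1⟩
    · exact ⟨0, 1, by rw [Matrix.det_fin_two_of]; simpa using h0⟩
  set P : GL (Fin 2) (ZMod p) := Matrix.GeneralLinearGroup.mkOfDetNeZero _ hdet with hP
  have hPv : (P : Matrix (Fin 2) (Fin 2) (ZMod p)) *ᵥ Pi.single 0 1 = v := by
    ext i
    rw [mulVec_single_zero_apply, hP, Matrix.GeneralLinearGroup.val_mkOfDetNeZero]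
    fin_cases i <;> rfl
  have hPinv_v : ((P⁻¹ : GL (Fin 2) (ZMod p)) : Matrix (Fin 2) (Fin 2) (ZMod p)) *ᵥ v = Pi.single 0 1 := by
    rw [← hPv, Matrix.mulVec_mulVec, ← Units.val_mul, inv_mul_cancel, Units.val_one, Matrix.one_mulVec]
  -- the conjugate hom `f' = P⁻¹ f P`
  set f' : Γ →* GL (Fin 2) (ZMod p) := (MulAut.conj P⁻¹).toMonoidHom.comp f with hf'
  have hf'apply : ∀ γ : Γ, f' γ = P⁻¹ * f γ * P := fun γ ↦ by
    rw [hf', MonoidHom.comp_apply, MulEquiv.coe_toMonoidHom, MulAut.conj_apply, inv_inv]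
  have hp' : ∀ γ : Γ, ¬ p ∣ orderOf (f' γ) := fun γ ↦ by
    rw [hf', MonoidHom.comp_apply, MulEquiv.coe_toMonoidHom, MulEquiv.orderOf_eq]; exact hp γ
  have hf'10 : ∀ γ : Γ, (f' γ : Matrix (Fin 2) (Fin 2) (ZMod p)) 1 0 = 0 := by
    intro γ
    obtain ⟨c, hc⟩ := hfv γ
    have key : ((f' γ : GL (Fin 2) (ZMod p)) : Matrix (Fin 2) (Fin 2) (ZMod p)) *ᵥ Pi.single 0 1 =
        c • Pi.single 0 1 := by
      rw [hf'apply, Units.val_mul, Units.val_mul, ← Matrix.mulVec_mulVec, ← Matrix.mulVec_mulVec, hPv, hc,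
        Matrix.mulVec_smul, hPinv_v]
    rw [← mulVec_single_zero_apply ((f' γ : GL (Fin 2) (ZMod p)) : Matrix (Fin 2) (Fin 2) (ZMod p)) 1, key]
    simp
  obtain ⟨w', hw'1, hfw'⟩ := exists_second_common_eigenvector_single_of_prime f' hp' hf'10
  refine ⟨(P : Matrix (Fin 2) (Fin 2) (ZMod p)) *ᵥ w', ?_, fun k hk ↦ ?_, fun γ ↦ ?_⟩
  · intro h0
    apply hw'1
    have : w' = 0 := by
      have h := congrArg (fun x ↦ ((P⁻¹ : GL (Fin 2) (ZMod p)) : Matrix (Fin 2) (Fin 2) (ZMod p)) *ᵥ x) h0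
      simpa only [Matrix.mulVec_mulVec, ← Units.val_mul, inv_mul_cancel, Units.val_one, Matrix.one_mulVec,
        Matrix.mulVec_zero] using h
    rw [this]; rfl
  · apply hw'1
    have h := congrArg (fun x ↦ ((P⁻¹ : GL (Fin 2) (ZMod p)) : Matrix (Fin 2) (Fin 2) (ZMod p)) *ᵥ x) hk
    simp only [Matrix.mulVec_mulVec, ← Units.val_mul, inv_mul_cancel, Units.val_one, Matrix.one_mulVec,
      Matrix.mulVec_smul] at h
    rw [hPinv_v] at h
    rw [h]
    simp
  · obtain ⟨c, hc⟩ := hfw' γ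
    refine ⟨c, ?_⟩
    have hmul : f γ * P = P * f' γ := by rw [hf'apply, ← mul_assoc, ← mul_assoc, mul_inv_cancel, one_mul]
    rw [Matrix.mulVec_mulVec, ← Units.val_mul, hmul, Units.val_mul, ← Matrix.mulVec_mulVec, hc,
      Matrix.mulVec_smul]

end Prime

end Summit.BirchSwinnertonDyer.BirchSwinnertonDyer.Theorems.PSIrrSurjThree
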